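import Summits.QuantumFields.YangMills.Theorems.BalabanLadderNTMarkovMirrorAffinePackage
import Summits.QuantumFields.YangMills.Theorems.BalabanLadderUVSeamRecFloorsEngineOfBareMirror
import HarnessLib

/-!
# Crux `UVSeamRec` (stmt-QuantumFields-20043), stub `stub_floorsEngine` (S-B): CHECK-LEMMAS — the registered
# statement from the MEASURE-TYPICAL Markov–mirror currencies at `rF` (bare floor; pinned-affine method lane)

Helper file (`--supports stmt-QuantumFields-20043`) of the seam stub-prover row `ym-20043-seam-s1` (owner RULINGS
R75 / R87: the (S-B) residual of record in Markov–mirror currency is {BL6, MF, clause (ii)}; the pinned-AFFINE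
currency (M-aff) is a METHOD lane for the bare mirror floor MF).  It is the specialisation «last file» of
`…NTMarkovMirrorBareTypicalPackage` (p520967) and `…NTMarkovMirrorAffinePackage` (p527524) — general `(G, r, a)` — to
`(SU(2), rF = fundamentalLatticeRep 2, a/uRec → c₀)`, parallel to p518416 `stubFloorsEngine_of_bareFloor_rF` (sup
currency {BL6, MF}).  Per coupling `β ≥ β₅` the data are ONE positive-time cube `Q_β = (c β, b β)` of physical size
`≤ Λ₅` carrying the lattice support of `v(aβ·)` at depth `≥ 2`, `Ṽ_v = ∑_{y ∈ Q_β} v(aβ·y) dens_y`, and on every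
torus `2L+1` with `Λ₅ ≤ aβ·L`:

* (MF)        `9ε/4 ≤ Cov_T(Ṽ_v∘Θ₀, Ṽ_v)` — the bare lattice mirror floor;
* (RBLΔ-L²)   `∫ (kerE_{Q_β}^{lift U}(Wᴿ_v) − kerE_{Q_β}^{lift U}(Ṽ_v) − p' β)² dμ_T(U) ≤ ε/4` — the chirality-defect
  boundary response in MEAN SQUARE under Wilson's torus measure (fed by a tempered / typical one-point law, e.g.
  `MarkovMirror.torusE_sq_le_of_goodLaw_and_rarity`, never necessarily by a `∀`-exterior law);
* (RBL-aff-L²) `∫ (kerE_{Q_β}^{lift U}(Ṽ_v) − p β + g₀ β + ∑_{b ∈ S β} g β b · plane_b(lift U))² dμ_T(U) ≤ ε/4` and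
  (SF-aff)     `4ε ≤ ∑_{b,b' ∈ S β} g β b · g β b' · Cov_T(plane_b∘Θ₀, plane_{b'})` for a finite plaquette family
  `S β` based in the closed collar `[c β − 1, c β + b β]` — the pinned-affine package, which gives (MF) by
  `MarkovMirror.bareFloors_of_affinePackage_l2`.

`stubFloorsEngine_of_bareFloor_l2_rF` ({MF, RBLΔ-L²}), `stubFloorsEngine_of_affinePackage_l2_rF`
({RBL-aff-L², SF-aff, RBLΔ-L²}) and `stubFloorsEngine_of_affinePackage_rF` (sup forms {RBL-aff, SF-aff, BL6}, the
defect fed from the plane-resolved boundary law by `defect_response_eventually_le`) conclude — together with the unit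
clauses `0 < a`, `a β / uRec β → c₀ > 0` and any supplier of the compact-witness three-point conjunct — the REGISTERED
`stub_floorsEngine` statement verbatim (v5(α) afcf556d5b76a240, byte-identical to v4-F f523973980851859:
`Transport.uRec`, `fundamentalLatticeRep 2`).  Nothing here is `SU(2)`-specific beyond the instantiation; no `UV`,
no two-point ceiling, no window is consumed.  Honest status: bookkeeping on a CONDITIONAL chain — MF, the supplier of
(RBLΔ-L²), (RBL-aff-L²)/(SF-aff) (an exterior linear-response law for conditional one-point functions of lattice
Yang–Mills and a floor on collar plaquette mirror covariances — unprinted) and clause (ii) are engine-grade inputs of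
crux `NT` (barrier `PerturbativeInvisibility`).  Refs: card E `Cruxes/NT/Ideas/markov-mirror-dirichlet-response.md`;
Osterwalder–Seiler 1978 §2; Glimm–Jaffe 1987 §6.1.
-/

set_option autoImplicit false

noncomputable section

open scoped SchwartzMap
open MeasureTheory Filter Topology
open Literature.MathematicalPhysics.QuantumFieldTheory Literature.MathematicalPhysics.QuantumLattice
open Literature.Probability.LatticeModels
open Summit.QuantumFields.YangMills.Cruxes.OSLegsFromFemtoAndGap.DlrCollarTransfer
open Summit.QuantumFields.YangMills.Cruxes.NT.MarkovMirror

namespace Summit.QuantumFields.YangMills.Cruxes.UVSeamRec.MarkovMirrorFloors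

/-- **CHECK-LEMMA (typical bare form): the REGISTERED `stub_floorsEngine` statement from {MF, RBLΔ-L²} at `rF`.**
For `SU(2)` with its Borel σ-algebra: a unit map `a > 0` with `a β / uRec β → c₀ > 0`; ONE compactly supported
positive-time `v`, `ε > 0`; per coupling a positive-time cube `Q_β` of physical size `≤ Λ₅` carrying the lattice
support of `v(aβ·)` at depth `≥ 2`; on every torus `aβ·L ≥ Λ₅` the mean-square chirality-defect bound (RBLΔ-L²)
`≤ ε/4` and the bare mirror floor (MF) `9ε/4 ≤ Cov_T(Ṽ_v∘Θ₀, Ṽ_v)`; any supplier of the three-point conjunct.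
Then the statement of `stub_floorsEngine` holds (`MarkovMirror.floorsTwoPoint_of_bareFloor_l2` at `rF`). [folklore] -/
theorem stubFloorsEngine_of_bareFloor_l2_rF
    (h : letI : MeasurableSpace (Matrix.specialUnitaryGroup (Fin 2) ℂ) := borel _
      haveI : BorelSpace (Matrix.specialUnitaryGroup (Fin 2) ℂ) := ⟨rfl⟩
      ∃ (a : ℝ → ℝ) (c₀ : ℝ), 0 < c₀ ∧ (∀ β, 0 < a β) ∧
        Tendsto (fun β => a β / Transport.uRec β) atTop (𝓝 c₀) ∧
      (∃ (v : 𝓢(EuclideanSpace ℝ (Fin 4), ℝ)) (ε β₅ Λ₅ : ℝ) (c : ℝ → (Fin 4 → ℤ)) (b : ℝ → ℕ) (p' : ℝ → ℝ),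
          HasCompactSupport (v : EuclideanSpace ℝ (Fin 4) → ℝ) ∧
          tsupport (v : EuclideanSpace ℝ (Fin 4) → ℝ) ⊆ {y | 0 < y 0} ∧ 0 < ε ∧
          (∀ β, β₅ ≤ β → 1 ≤ c β 0 ∧ ∀ j : Fin 4, (|((c β j : ℤ) : ℝ)| + (b β : ℝ) + 3) * a β ≤ Λ₅) ∧
          (∀ β, β₅ ≤ β → ∀ x : Fin 4 → ℤ, v (a β • siteToE x) ≠ 0 →
            x ∈ cubeSites (c β) (b β) ∧ 2 ≤ depth (c β) (b β) x) ∧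
          (∀ β, β₅ ≤ β → ∀ L : ℕ, Λ₅ ≤ a β * L →
            torusE (Matrix.specialUnitaryGroup (Fin 2) ℂ) (fundamentalLatticeRep 2) β L (fun V =>
              (kerE (Matrix.specialUnitaryGroup (Fin 2) ℂ) (fundamentalLatticeRep 2) β (c β) (b β) V
                  (fun V => ∑ x ∈ cubeSites (c β) (b β), v (a β • siteToE x) *
                    ∑ q : {q : Fin 4 × Fin 4 // q.1 < q.2},
                      plane (Matrix.specialUnitaryGroup (Fin 2) ℂ) (fundamentalLatticeRep 2) q.1
                        (if q.1.1 = 0 then x - Pi.single 0 1 else x) V) -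
                kerE (Matrix.specialUnitaryGroup (Fin 2) ℂ) (fundamentalLatticeRep 2) β (c β) (b β) V
                  (fun V => ∑ y ∈ cubeSites (c β) (b β), v (a β • siteToE y) *
                    dens (Matrix.specialUnitaryGroup (Fin 2) ℂ) (fundamentalLatticeRep 2) y V) -
                p' β) ^ 2) ≤ ε / 4) ∧
          (∀ β, β₅ ≤ β → ∀ L : ℕ, Λ₅ ≤ a β * L →
            9 * ε / 4 ≤ torusE (Matrix.specialUnitaryGroup (Fin 2) ℂ) (fundamentalLatticeRep 2) β L (fun V =>
                (∑ y ∈ cubeSites (c β) (b β), v (a β • siteToE y) *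
                    dens (Matrix.specialUnitaryGroup (Fin 2) ℂ) (fundamentalLatticeRep 2) y (cfgReflect V)) *
                  ∑ y ∈ cubeSites (c β) (b β), v (a β • siteToE y) *
                    dens (Matrix.specialUnitaryGroup (Fin 2) ℂ) (fundamentalLatticeRep 2) y V) -
              torusE (Matrix.specialUnitaryGroup (Fin 2) ℂ) (fundamentalLatticeRep 2) β L (fun V =>
                  ∑ y ∈ cubeSites (c β) (b β), v (a β • siteToE y) *
                    dens (Matrix.specialUnitaryGroup (Fin 2) ℂ) (fundamentalLatticeRep 2) y (cfgReflect V)) *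
                torusE (Matrix.specialUnitaryGroup (Fin 2) ℂ) (fundamentalLatticeRep 2) β L (fun V =>
                  ∑ y ∈ cubeSites (c β) (b β), v (a β • siteToE y) *
                    dens (Matrix.specialUnitaryGroup (Fin 2) ℂ) (fundamentalLatticeRep 2) y V))) ∧
      (∃ (f g h : 𝓢(EuclideanSpace ℝ (Fin 4), ℝ)) (ε β₅ Λ₅ : ℝ),
        HasCompactSupport (f : EuclideanSpace ℝ (Fin 4) → ℝ) ∧
        HasCompactSupport (g : EuclideanSpace ℝ (Fin 4) → ℝ) ∧
        HasCompactSupport (h : EuclideanSpace ℝ (Fin 4) → ℝ) ∧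
        Disjoint (tsupport (f : EuclideanSpace ℝ (Fin 4) → ℝ)) (tsupport (g : EuclideanSpace ℝ (Fin 4) → ℝ)) ∧
        Disjoint (tsupport (g : EuclideanSpace ℝ (Fin 4) → ℝ)) (tsupport (h : EuclideanSpace ℝ (Fin 4) → ℝ)) ∧
        Disjoint (tsupport (f : EuclideanSpace ℝ (Fin 4) → ℝ)) (tsupport (h : EuclideanSpace ℝ (Fin 4) → ℝ)) ∧
        0 < ε ∧ ∀ β : ℝ, β₅ ≤ β → ∀ L : ℕ, Λ₅ ≤ a β * L →
          ε ≤ |Q3 (Matrix.specialUnitaryGroup (Fin 2) ℂ) (fundamentalLatticeRep 2) β L (a β) f g h|)) :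
    letI : MeasurableSpace (Matrix.specialUnitaryGroup (Fin 2) ℂ) := borel _
    haveI : BorelSpace (Matrix.specialUnitaryGroup (Fin 2) ℂ) := ⟨rfl⟩
    ∃ (a : ℝ → ℝ) (c₀ : ℝ), 0 < c₀ ∧ (∀ β, 0 < a β) ∧
      Tendsto (fun β => a β / Transport.uRec β) atTop (𝓝 c₀) ∧
      (∃ (v : 𝓢(EuclideanSpace ℝ (Fin 4), ℝ)) (ε β₅ Λ₅ : ℝ),
        HasCompactSupport (v : EuclideanSpace ℝ (Fin 4) → ℝ) ∧
        tsupport (v : EuclideanSpace ℝ (Fin 4) → ℝ) ⊆ {y : EuclideanSpace ℝ (Fin 4) | 0 < y 0} ∧ 0 < ε ∧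
        ∀ β : ℝ, β₅ ≤ β → ∀ L : ℕ, Λ₅ ≤ a β * L →
          ε ≤ Q2 (Matrix.specialUnitaryGroup (Fin 2) ℂ) (fundamentalLatticeRep 2) β L (a β) (thetaTest 4 v) v) ∧
      (∃ (f g h : 𝓢(EuclideanSpace ℝ (Fin 4), ℝ)) (ε β₅ Λ₅ : ℝ),
        HasCompactSupport (f : EuclideanSpace ℝ (Fin 4) → ℝ) ∧
        HasCompactSupport (g : EuclideanSpace ℝ (Fin 4) → ℝ) ∧
        HasCompactSupport (h : EuclideanSpace ℝ (Fin 4) → ℝ) ∧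
        Disjoint (tsupport (f : EuclideanSpace ℝ (Fin 4) → ℝ)) (tsupport (g : EuclideanSpace ℝ (Fin 4) → ℝ)) ∧
        Disjoint (tsupport (g : EuclideanSpace ℝ (Fin 4) → ℝ)) (tsupport (h : EuclideanSpace ℝ (Fin 4) → ℝ)) ∧
        Disjoint (tsupport (f : EuclideanSpace ℝ (Fin 4) → ℝ)) (tsupport (h : EuclideanSpace ℝ (Fin 4) → ℝ)) ∧
        0 < ε ∧ ∀ β : ℝ, β₅ ≤ β → ∀ L : ℕ, Λ₅ ≤ a β * L →
          ε ≤ |Q3 (Matrix.specialUnitaryGroup (Fin 2) ℂ) (fundamentalLatticeRep 2) β L (a β) f g h|) := by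
  letI : MeasurableSpace (Matrix.specialUnitaryGroup (Fin 2) ℂ) := borel _
  haveI : BorelSpace (Matrix.specialUnitaryGroup (Fin 2) ℂ) := ⟨rfl⟩
  obtain ⟨a, c₀, hc₀, ha₀, hau, ⟨v, ε, β₅, Λ₅, c, b, p', hvK, hv, hε, hgeom, hsupp, hΔ2, hMF⟩, h3⟩ := h
  exact ⟨a, c₀, hc₀, ha₀, hau,
    floorsTwoPoint_of_bareFloor_l2 (Matrix.specialUnitaryGroup (Fin 2) ℂ) (fundamentalLatticeRep 2) a ha₀ v hvK hv
      hε c b p' hgeom hsupp hΔ2 hMF, h3⟩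

/-- **CHECK-LEMMA (typical affine form, method lane (M-aff)): the REGISTERED `stub_floorsEngine` statement from
{RBL-aff-L², SF-aff, RBLΔ-L²} at `rF`.**  As `stubFloorsEngine_of_bareFloor_l2_rF`, with the bare mirror floor (MF)
replaced by its pinned-affine supplier: per coupling a finite plaquette family `S β` based in the closed collar
`[c β − 1, c β + b β]`, coefficients `g β`, constants `g₀ β, p β`, the mean-square affine response law (RBL-aff-L²)
`≤ ε/4` for the cube's conditional mean of `Ṽ_v` and the floor (SF-aff) `4ε ≤ ∑ g g' Cov_T(plane∘Θ₀, plane')` on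
every torus `aβ·L ≥ Λ₅` (`MarkovMirror.floorsTwoPoint_of_affinePackage_l2` at `rF`). [folklore] -/
theorem stubFloorsEngine_of_affinePackage_l2_rF
    (h : letI : MeasurableSpace (Matrix.specialUnitaryGroup (Fin 2) ℂ) := borel _
      haveI : BorelSpace (Matrix.specialUnitaryGroup (Fin 2) ℂ) := ⟨rfl⟩
      ∃ (a : ℝ → ℝ) (c₀ : ℝ), 0 < c₀ ∧ (∀ β, 0 < a β) ∧
        Tendsto (fun β => a β / Transport.uRec β) atTop (𝓝 c₀) ∧
      (∃ (v : 𝓢(EuclideanSpace ℝ (Fin 4), ℝ)) (ε β₅ Λ₅ : ℝ) (c : ℝ → (Fin 4 → ℤ)) (b : ℝ → ℕ)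
          (S : ℝ → Finset ((Fin 4 × Fin 4) × (Fin 4 → ℤ))) (g₀ : ℝ → ℝ)
          (g : ℝ → (Fin 4 × Fin 4) × (Fin 4 → ℤ) → ℝ) (p p' : ℝ → ℝ),
          HasCompactSupport (v : EuclideanSpace ℝ (Fin 4) → ℝ) ∧
          tsupport (v : EuclideanSpace ℝ (Fin 4) → ℝ) ⊆ {y | 0 < y 0} ∧ 0 < ε ∧
          (∀ β, β₅ ≤ β → 1 ≤ c β 0 ∧ ∀ j : Fin 4, (|((c β j : ℤ) : ℝ)| + (b β : ℝ) + 3) * a β ≤ Λ₅) ∧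
          (∀ β, β₅ ≤ β → ∀ x : Fin 4 → ℤ, v (a β • siteToE x) ≠ 0 →
            x ∈ cubeSites (c β) (b β) ∧ 2 ≤ depth (c β) (b β) x) ∧
          (∀ β, β₅ ≤ β → ∀ pl ∈ S β, ∀ j : Fin 4, c β j - 1 ≤ pl.2 j ∧ pl.2 j ≤ c β j + b β) ∧
          (∀ β, β₅ ≤ β → ∀ L : ℕ, Λ₅ ≤ a β * L →
            torusE (Matrix.specialUnitaryGroup (Fin 2) ℂ) (fundamentalLatticeRep 2) β L (fun V =>
              (kerE (Matrix.specialUnitaryGroup (Fin 2) ℂ) (fundamentalLatticeRep 2) β (c β) (b β) V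
                  (fun V => ∑ y ∈ cubeSites (c β) (b β), v (a β • siteToE y) *
                    dens (Matrix.specialUnitaryGroup (Fin 2) ℂ) (fundamentalLatticeRep 2) y V) -
                p β + (g₀ β + ∑ pl ∈ S β, g β pl *
                  plane (Matrix.specialUnitaryGroup (Fin 2) ℂ) (fundamentalLatticeRep 2) pl.1 pl.2 V)) ^ 2) ≤
              ε / 4) ∧
          (∀ β, β₅ ≤ β → ∀ L : ℕ, Λ₅ ≤ a β * L →
            4 * ε ≤ ∑ pl ∈ S β, ∑ pl' ∈ S β, g β pl * g β pl' *
              (torusE (Matrix.specialUnitaryGroup (Fin 2) ℂ) (fundamentalLatticeRep 2) β L (fun V =>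
                  plane (Matrix.specialUnitaryGroup (Fin 2) ℂ) (fundamentalLatticeRep 2) pl.1 pl.2 (cfgReflect V) *
                    plane (Matrix.specialUnitaryGroup (Fin 2) ℂ) (fundamentalLatticeRep 2) pl'.1 pl'.2 V) -
                torusE (Matrix.specialUnitaryGroup (Fin 2) ℂ) (fundamentalLatticeRep 2) β L (fun V =>
                    plane (Matrix.specialUnitaryGroup (Fin 2) ℂ) (fundamentalLatticeRep 2) pl.1 pl.2 (cfgReflect V)) *
                  torusE (Matrix.specialUnitaryGroup (Fin 2) ℂ) (fundamentalLatticeRep 2) β L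
                    (plane (Matrix.specialUnitaryGroup (Fin 2) ℂ) (fundamentalLatticeRep 2) pl'.1 pl'.2))) ∧
          (∀ β, β₅ ≤ β → ∀ L : ℕ, Λ₅ ≤ a β * L →
            torusE (Matrix.specialUnitaryGroup (Fin 2) ℂ) (fundamentalLatticeRep 2) β L (fun V =>
              (kerE (Matrix.specialUnitaryGroup (Fin 2) ℂ) (fundamentalLatticeRep 2) β (c β) (b β) V
                  (fun V => ∑ x ∈ cubeSites (c β) (b β), v (a β • siteToE x) *
                    ∑ q : {q : Fin 4 × Fin 4 // q.1 < q.2},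
                      plane (Matrix.specialUnitaryGroup (Fin 2) ℂ) (fundamentalLatticeRep 2) q.1
                        (if q.1.1 = 0 then x - Pi.single 0 1 else x) V) -
                kerE (Matrix.specialUnitaryGroup (Fin 2) ℂ) (fundamentalLatticeRep 2) β (c β) (b β) V
                  (fun V => ∑ y ∈ cubeSites (c β) (b β), v (a β • siteToE y) *
                    dens (Matrix.specialUnitaryGroup (Fin 2) ℂ) (fundamentalLatticeRep 2) y V) -
                p' β) ^ 2) ≤ ε / 4)) ∧
      (∃ (f g h : 𝓢(EuclideanSpace ℝ (Fin 4), ℝ)) (ε β₅ Λ₅ : ℝ),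
        HasCompactSupport (f : EuclideanSpace ℝ (Fin 4) → ℝ) ∧
        HasCompactSupport (g : EuclideanSpace ℝ (Fin 4) → ℝ) ∧
        HasCompactSupport (h : EuclideanSpace ℝ (Fin 4) → ℝ) ∧
        Disjoint (tsupport (f : EuclideanSpace ℝ (Fin 4) → ℝ)) (tsupport (g : EuclideanSpace ℝ (Fin 4) → ℝ)) ∧
        Disjoint (tsupport (g : EuclideanSpace ℝ (Fin 4) → ℝ)) (tsupport (h : EuclideanSpace ℝ (Fin 4) → ℝ)) ∧
        Disjoint (tsupport (f : EuclideanSpace ℝ (Fin 4) → ℝ)) (tsupport (h : EuclideanSpace ℝ (Fin 4) → ℝ)) ∧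
        0 < ε ∧ ∀ β : ℝ, β₅ ≤ β → ∀ L : ℕ, Λ₅ ≤ a β * L →
          ε ≤ |Q3 (Matrix.specialUnitaryGroup (Fin 2) ℂ) (fundamentalLatticeRep 2) β L (a β) f g h|)) :
    letI : MeasurableSpace (Matrix.specialUnitaryGroup (Fin 2) ℂ) := borel _
    haveI : BorelSpace (Matrix.specialUnitaryGroup (Fin 2) ℂ) := ⟨rfl⟩
    ∃ (a : ℝ → ℝ) (c₀ : ℝ), 0 < c₀ ∧ (∀ β, 0 < a β) ∧
      Tendsto (fun β => a β / Transport.uRec β) atTop (𝓝 c₀) ∧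
      (∃ (v : 𝓢(EuclideanSpace ℝ (Fin 4), ℝ)) (ε β₅ Λ₅ : ℝ),
        HasCompactSupport (v : EuclideanSpace ℝ (Fin 4) → ℝ) ∧
        tsupport (v : EuclideanSpace ℝ (Fin 4) → ℝ) ⊆ {y : EuclideanSpace ℝ (Fin 4) | 0 < y 0} ∧ 0 < ε ∧
        ∀ β : ℝ, β₅ ≤ β → ∀ L : ℕ, Λ₅ ≤ a β * L →
          ε ≤ Q2 (Matrix.specialUnitaryGroup (Fin 2) ℂ) (fundamentalLatticeRep 2) β L (a β) (thetaTest 4 v) v) ∧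
      (∃ (f g h : 𝓢(EuclideanSpace ℝ (Fin 4), ℝ)) (ε β₅ Λ₅ : ℝ),
        HasCompactSupport (f : EuclideanSpace ℝ (Fin 4) → ℝ) ∧
        HasCompactSupport (g : EuclideanSpace ℝ (Fin 4) → ℝ) ∧
        HasCompactSupport (h : EuclideanSpace ℝ (Fin 4) → ℝ) ∧
        Disjoint (tsupport (f : EuclideanSpace ℝ (Fin 4) → ℝ)) (tsupport (g : EuclideanSpace ℝ (Fin 4) → ℝ)) ∧
        Disjoint (tsupport (g : EuclideanSpace ℝ (Fin 4) → ℝ)) (tsupport (h : EuclideanSpace ℝ (Fin 4) → ℝ)) ∧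
        Disjoint (tsupport (f : EuclideanSpace ℝ (Fin 4) → ℝ)) (tsupport (h : EuclideanSpace ℝ (Fin 4) → ℝ)) ∧
        0 < ε ∧ ∀ β : ℝ, β₅ ≤ β → ∀ L : ℕ, Λ₅ ≤ a β * L →
          ε ≤ |Q3 (Matrix.specialUnitaryGroup (Fin 2) ℂ) (fundamentalLatticeRep 2) β L (a β) f g h|) := by
  letI : MeasurableSpace (Matrix.specialUnitaryGroup (Fin 2) ℂ) := borel _
  haveI : BorelSpace (Matrix.specialUnitaryGroup (Fin 2) ℂ) := ⟨rfl⟩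
  obtain ⟨a, c₀, hc₀, ha₀, hau, ⟨v, ε, β₅, Λ₅, c, b, S, g₀, g, p, p', hvK, hv, hε, hgeom, hsupp, hS, hRBL2, hSF,
    hΔ2⟩, h3⟩ := h
  exact ⟨a, c₀, hc₀, ha₀, hau,
    floorsTwoPoint_of_affinePackage_l2 (Matrix.specialUnitaryGroup (Fin 2) ℂ) (fundamentalLatticeRep 2) a ha₀ v hvK
      hv hε c b S g₀ g p p' hgeom hsupp hS hRBL2 hSF hΔ2, h3⟩

/-- **CHECK-LEMMA (sup affine form): the REGISTERED `stub_floorsEngine` statement from {RBL-aff, SF-aff, BL6} at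
`rF`** — the hypothesis of p518416 `stubFloorsEngine_of_bareFloor_rF` with (MF) replaced by its pinned-affine
supplier in SUP form: (RBL-aff) `|kerE_{Q_β}^ζ(Ṽ_v) − p β + g₀ β + ∑_b g β b · plane_b ζ| ≤ √ε/2` for EVERY exterior
`ζ`, (SF-aff) as above, and (BL6) the plane-resolved boundary law on the `e₀`-thickened support at physical depth
`≥ κ`.  Mechanism: `rblAff_l2_of_sup` (sup ⇒ mean square), `defect_response_eventually_le` ((RBLΔ) from (BL6),
`O(aβ)`, eventually `≤ √ε/2`), `rblΔ_l2_of_sup`, then `floorsTwoPoint_of_affinePackage_l2` on `β ≥ max β₅ β₆`.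
Recorded for completeness beside the typical form (the sup laws imply the mean-square ones torus by torus). [folklore] -/
theorem stubFloorsEngine_of_affinePackage_rF
    (h : letI : MeasurableSpace (Matrix.specialUnitaryGroup (Fin 2) ℂ) := borel _
      haveI : BorelSpace (Matrix.specialUnitaryGroup (Fin 2) ℂ) := ⟨rfl⟩
      ∃ (a : ℝ → ℝ) (c₀ : ℝ), 0 < c₀ ∧ (∀ β, 0 < a β) ∧
        Tendsto (fun β => a β / Transport.uRec β) atTop (𝓝 c₀) ∧
      (∃ (v : 𝓢(EuclideanSpace ℝ (Fin 4), ℝ)) (ε β₅ Λ₅ κ C₁ : ℝ) (c : ℝ → (Fin 4 → ℤ)) (b : ℝ → ℕ)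
          (p6 : ℝ → {q : Fin 4 × Fin 4 // q.1 < q.2} → ℝ)
          (S : ℝ → Finset ((Fin 4 × Fin 4) × (Fin 4 → ℤ))) (g₀ : ℝ → ℝ)
          (g : ℝ → (Fin 4 × Fin 4) × (Fin 4 → ℤ) → ℝ) (p : ℝ → ℝ),
          HasCompactSupport (v : EuclideanSpace ℝ (Fin 4) → ℝ) ∧
          tsupport (v : EuclideanSpace ℝ (Fin 4) → ℝ) ⊆ {y | 0 < y 0} ∧ 0 < ε ∧ 0 < κ ∧ 0 ≤ C₁ ∧
          (∀ β, β₅ ≤ β → 1 ≤ c β 0 ∧ ∀ j : Fin 4, (|((c β j : ℤ) : ℝ)| + (b β : ℝ) + 3) * a β ≤ Λ₅) ∧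
          (∀ β, β₅ ≤ β → ∀ x : Fin 4 → ℤ, v (a β • siteToE x) ≠ 0 →
            x ∈ cubeSites (c β) (b β) ∧ 2 ≤ depth (c β) (b β) x) ∧
          (∀ β, β₅ ≤ β → ∀ x : Fin 4 → ℤ,
            (v (a β • siteToE x) ≠ 0 ∨ v (a β • siteToE (x + Pi.single 0 1)) ≠ 0) →
              x ∈ cubeSites (c β) (b β) ∧ κ / a β ≤ (depth (c β) (b β) x : ℝ)) ∧
          (∀ β, β₅ ≤ β → ∀ (ζ : LGConfig 4 (Matrix.specialUnitaryGroup (Fin 2) ℂ))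
            (q : {q : Fin 4 × Fin 4 // q.1 < q.2}), q.1.1 = 0 → ∀ x ∈ cubeSites (c β) (b β),
              (v (a β • siteToE x) ≠ 0 ∨ v (a β • siteToE (x + Pi.single 0 1)) ≠ 0) →
                |kerE (Matrix.specialUnitaryGroup (Fin 2) ℂ) (fundamentalLatticeRep 2) β (c β) (b β) ζ
                    (plane (Matrix.specialUnitaryGroup (Fin 2) ℂ) (fundamentalLatticeRep 2) q.1 x) - p6 β q| ≤
                  C₁ / (depth (c β) (b β) x : ℝ) ^ 4) ∧
          (∀ β, β₅ ≤ β → ∀ pl ∈ S β, ∀ j : Fin 4, c β j - 1 ≤ pl.2 j ∧ pl.2 j ≤ c β j + b β) ∧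
          (∀ β, β₅ ≤ β → ∀ ζ : LGConfig 4 (Matrix.specialUnitaryGroup (Fin 2) ℂ),
            |kerE (Matrix.specialUnitaryGroup (Fin 2) ℂ) (fundamentalLatticeRep 2) β (c β) (b β) ζ
                  (fun V => ∑ y ∈ cubeSites (c β) (b β), v (a β • siteToE y) *
                    dens (Matrix.specialUnitaryGroup (Fin 2) ℂ) (fundamentalLatticeRep 2) y V) -
                p β + (g₀ β + ∑ pl ∈ S β, g β pl *
                  plane (Matrix.specialUnitaryGroup (Fin 2) ℂ) (fundamentalLatticeRep 2) pl.1 pl.2 ζ)| ≤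
              Real.sqrt ε / 2) ∧
          (∀ β, β₅ ≤ β → ∀ L : ℕ, Λ₅ ≤ a β * L →
            4 * ε ≤ ∑ pl ∈ S β, ∑ pl' ∈ S β, g β pl * g β pl' *
              (torusE (Matrix.specialUnitaryGroup (Fin 2) ℂ) (fundamentalLatticeRep 2) β L (fun V =>
                  plane (Matrix.specialUnitaryGroup (Fin 2) ℂ) (fundamentalLatticeRep 2) pl.1 pl.2 (cfgReflect V) *
                    plane (Matrix.specialUnitaryGroup (Fin 2) ℂ) (fundamentalLatticeRep 2) pl'.1 pl'.2 V) -
                torusE (Matrix.specialUnitaryGroup (Fin 2) ℂ) (fundamentalLatticeRep 2) β L (fun V =>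
                    plane (Matrix.specialUnitaryGroup (Fin 2) ℂ) (fundamentalLatticeRep 2) pl.1 pl.2 (cfgReflect V)) *
                  torusE (Matrix.specialUnitaryGroup (Fin 2) ℂ) (fundamentalLatticeRep 2) β L
                    (plane (Matrix.specialUnitaryGroup (Fin 2) ℂ) (fundamentalLatticeRep 2) pl'.1 pl'.2)))) ∧
      (∃ (f g h : 𝓢(EuclideanSpace ℝ (Fin 4), ℝ)) (ε β₅ Λ₅ : ℝ),
        HasCompactSupport (f : EuclideanSpace ℝ (Fin 4) → ℝ) ∧
        HasCompactSupport (g : EuclideanSpace ℝ (Fin 4) → ℝ) ∧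
        HasCompactSupport (h : EuclideanSpace ℝ (Fin 4) → ℝ) ∧
        Disjoint (tsupport (f : EuclideanSpace ℝ (Fin 4) → ℝ)) (tsupport (g : EuclideanSpace ℝ (Fin 4) → ℝ)) ∧
        Disjoint (tsupport (g : EuclideanSpace ℝ (Fin 4) → ℝ)) (tsupport (h : EuclideanSpace ℝ (Fin 4) → ℝ)) ∧
        Disjoint (tsupport (f : EuclideanSpace ℝ (Fin 4) → ℝ)) (tsupport (h : EuclideanSpace ℝ (Fin 4) → ℝ)) ∧
        0 < ε ∧ ∀ β : ℝ, β₅ ≤ β → ∀ L : ℕ, Λ₅ ≤ a β * L →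
          ε ≤ |Q3 (Matrix.specialUnitaryGroup (Fin 2) ℂ) (fundamentalLatticeRep 2) β L (a β) f g h|)) :
    letI : MeasurableSpace (Matrix.specialUnitaryGroup (Fin 2) ℂ) := borel _
    haveI : BorelSpace (Matrix.specialUnitaryGroup (Fin 2) ℂ) := ⟨rfl⟩
    ∃ (a : ℝ → ℝ) (c₀ : ℝ), 0 < c₀ ∧ (∀ β, 0 < a β) ∧
      Tendsto (fun β => a β / Transport.uRec β) atTop (𝓝 c₀) ∧
      (∃ (v : 𝓢(EuclideanSpace ℝ (Fin 4), ℝ)) (ε β₅ Λ₅ : ℝ),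
        HasCompactSupport (v : EuclideanSpace ℝ (Fin 4) → ℝ) ∧
        tsupport (v : EuclideanSpace ℝ (Fin 4) → ℝ) ⊆ {y : EuclideanSpace ℝ (Fin 4) | 0 < y 0} ∧ 0 < ε ∧
        ∀ β : ℝ, β₅ ≤ β → ∀ L : ℕ, Λ₅ ≤ a β * L →
          ε ≤ Q2 (Matrix.specialUnitaryGroup (Fin 2) ℂ) (fundamentalLatticeRep 2) β L (a β) (thetaTest 4 v) v) ∧
      (∃ (f g h : 𝓢(EuclideanSpace ℝ (Fin 4), ℝ)) (ε β₅ Λ₅ : ℝ),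
        HasCompactSupport (f : EuclideanSpace ℝ (Fin 4) → ℝ) ∧
        HasCompactSupport (g : EuclideanSpace ℝ (Fin 4) → ℝ) ∧
        HasCompactSupport (h : EuclideanSpace ℝ (Fin 4) → ℝ) ∧
        Disjoint (tsupport (f : EuclideanSpace ℝ (Fin 4) → ℝ)) (tsupport (g : EuclideanSpace ℝ (Fin 4) → ℝ)) ∧
        Disjoint (tsupport (g : EuclideanSpace ℝ (Fin 4) → ℝ)) (tsupport (h : EuclideanSpace ℝ (Fin 4) → ℝ)) ∧
        Disjoint (tsupport (f : EuclideanSpace ℝ (Fin 4) → ℝ)) (tsupport (h : EuclideanSpace ℝ (Fin 4) → ℝ)) ∧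
        0 < ε ∧ ∀ β : ℝ, β₅ ≤ β → ∀ L : ℕ, Λ₅ ≤ a β * L →
          ε ≤ |Q3 (Matrix.specialUnitaryGroup (Fin 2) ℂ) (fundamentalLatticeRep 2) β L (a β) f g h|) := by
  letI : MeasurableSpace (Matrix.specialUnitaryGroup (Fin 2) ℂ) := borel _
  haveI : BorelSpace (Matrix.specialUnitaryGroup (Fin 2) ℂ) := ⟨rfl⟩
  obtain ⟨a, c₀, hc₀, ha₀, hau, ⟨v, ε, β₅, Λ₅, κ, C₁, c, b, p6, S, g₀, g, p, hvK, hv, hε, hκ, hC₁, hgeom, hsupp,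
    hthick, hBL, hS, hRBL, hSF⟩, h3⟩ := h
  have ha : Tendsto a atTop (𝓝 0) := ReferenceFloors.tendsto_zero_of_ratio hau
  -- (RBLΔ) from the boundary law, eventually (sup form)
  have hη : 0 < Real.sqrt ε / 2 := by positivity
  obtain ⟨β₆, hΔ⟩ := defect_response_eventually_le (Matrix.specialUnitaryGroup (Fin 2) ℂ) (fundamentalLatticeRep 2)
    a ha₀ ha v hvK hκ hC₁ c b p6 hsupp hthick hBL hη
  -- the two-point floor for the SAME `v`, from the mean-square forms of {RBL-aff, RBLΔ} and (SF-aff) on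
  -- `β ≥ max β₅ β₆`
  have key := floorsTwoPoint_of_affinePackage_l2 (Matrix.specialUnitaryGroup (Fin 2) ℂ) (fundamentalLatticeRep 2)
    a ha₀ v hvK hv hε (β₅ := max β₅ β₆) (Λ₅ := Λ₅) c b S g₀ g p
    (fun β => ∑ x ∈ cubeSites (c β) (b β), (v (a β • siteToE (x + Pi.single 0 1)) - v (a β • siteToE x)) *
      ∑ q : {q : Fin 4 × Fin 4 // q.1 < q.2}, (if q.1.1 = 0 then p6 β q else 0))
    (fun β hβ => hgeom β (le_trans (le_max_left _ _) hβ))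
    (fun β hβ => hsupp β (le_trans (le_max_left _ _) hβ))
    (fun β hβ => hS β (le_trans (le_max_left _ _) hβ))
    (fun β hβ L _ => by
      obtain ⟨MW, hMW⟩ := exists_abs_cubeSmear_le (Matrix.specialUnitaryGroup (Fin 2) ℂ) (fundamentalLatticeRep 2)
        (c β) (b β) (fun y => v (a β • siteToE y))
      exact rblAff_l2_of_sup (Matrix.specialUnitaryGroup (Fin 2) ℂ) (fundamentalLatticeRep 2) β L (c β) (b β)
        (continuous_cubeSmear (Matrix.specialUnitaryGroup (Fin 2) ℂ) (fundamentalLatticeRep 2) (c β) (b β) _) hMW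
        (S β) (g₀ β) (g β) (p β) hε.le (hRBL β (le_trans (le_max_left _ _) hβ)))
    (fun β hβ => hSF β (le_trans (le_max_left _ _) hβ))
    (fun β hβ L _ => rblΔ_l2_of_sup (Matrix.specialUnitaryGroup (Fin 2) ℂ) (fundamentalLatticeRep 2) β L (c β)
      (b β) (a β) v _ hε.le (hΔ β (le_trans (le_max_right _ _) hβ)))
  exact ⟨a, c₀, hc₀, ha₀, hau, key, h3⟩

end Summit.QuantumFields.YangMills.Cruxes.UVSeamRec.MarkovMirrorFloors

end
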